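import Mathlib
import Summits.Ventures.HodgeRepro.Tier4.Common.MixedPlane

/-!
# Tier4/Common/PlaneGenuine — the non-degeneracy predicate on `PlaneData` (rank-two projectors, a genuine quadratic
`E′`-structure, a non-degenerate trace form), and the proof that the planes built from lines are genuine
(the repair of t4-crit-2's O2, S12249: `P 0 := 1, P 1 := 0` and `Ω := 1` are `PlaneData`)

Blind re-derivation cell `pub-hodge-repro`, Tier 4 (README §9–§10), seat t4-typer-2 (gen 0).  Target tree path
`lean/Summits/Ventures/HodgeRepro/Tier4/Common/PlaneGenuine.lean`.  Imports `Tier4/Common/MixedPlane.lean`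
(`QuadData`, `omegaMat`, `lineGram`, `blockDiag4`, `PlaneData.ofLines`).

`PlaneData` (AdelicDefs, landed, append-only) records only the matrix identities a plane with two decompositions
satisfies; it admits the degenerate `P 0 := 1, P 1 := 0` (the «torus» is the whole group) and `Ω := 1` (the
«unitary group» is the orthogonal group of the trace form).  **`IsGenuinePlane q W`** adds, as a DEFINED predicate a
line states on its plane: the projectors have trace `2` (= rank `2` for an idempotent in characteristic `0`: each
line is two-dimensional over `k`, one-dimensional over `E′`), `Ω` satisfies the quadratic relation
`Ω² = t Ω − n` of `E′ = k(ω)` and is not a scalar (so `k[Ω] ≅ E′` is two-dimensional), and the trace form is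
non-degenerate (`det B ≠ 0`).  **`ofLines_isGenuine`**: the plane `⟨a⟩ ⊕ ⟨ε b⟩` of `MixedPlane.lean` IS genuine as
soon as `a, b, ε ≠ 0` and `t² − 4n ≠ 0` (`E′ ≠ k × k`) — so every seesaw / mixed plane of the face passes the
predicate by construction, and the degenerate instances of S12249 fail it.

Nothing here says anything about the status of the Hodge conjecture for CM abelian varieties, which is NOT proved
(HC_CM is NOT proved by anyone in this repository).
-/

set_option autoImplicit false

noncomputable section

namespace Summit.Ventures.HodgeRepro.Tier4.Common

open Matrix

section Genuine

variable {k : Type} [Field k]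

/-- **A genuine plane**: rank-two projectors (trace `2`), the quadratic relation and non-scalarity of `Ω`, a
non-degenerate trace form. -/
def IsGenuinePlane (q : QuadData k) (W : PlaneData k) : Prop :=
  (∀ i, Matrix.trace (W.P i) = 2) ∧ (∀ i, Matrix.trace (W.Q i) = 2) ∧
    W.Ω * W.Ω = q.t • W.Ω - q.n • (1 : Matrix (Fin 4) (Fin 4) k) ∧ (∀ c : k, W.Ω ≠ c • (1 : Matrix (Fin 4) (Fin 4) k)) ∧
    W.B.det ≠ 0

/-- The trace of a reindexed square matrix. -/
theorem trace_reindex_self {m n : Type} [Fintype m] [Fintype n] [DecidableEq m] [DecidableEq n] (e : m ≃ n)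
    (M : Matrix m m k) : Matrix.trace (Matrix.reindex e e M) = Matrix.trace M := by
  simp only [Matrix.trace, Matrix.diag, Matrix.reindex_apply, Matrix.submatrix_apply]
  exact Fintype.sum_equiv e.symm _ _ fun _ => rfl

/-- The trace of a block-diagonal matrix. -/
theorem trace_blockDiag4 (A D : Matrix (Fin 2) (Fin 2) k) :
    Matrix.trace (blockDiag4 A D) = Matrix.trace A + Matrix.trace D := by
  simp only [blockDiag4, re4, coe_reindexAlgEquiv, trace_reindex_self]
  simp [Matrix.trace, Matrix.diag, Fintype.sum_sum_type, Matrix.fromBlocks_apply₁₁, Matrix.fromBlocks_apply₂₂]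

/-- The determinant of a block-diagonal matrix. -/
theorem det_blockDiag4 (A D : Matrix (Fin 2) (Fin 2) k) : (blockDiag4 A D).det = A.det * D.det := by
  simp only [blockDiag4, re4, coe_reindexAlgEquiv, Matrix.det_reindex_self, Matrix.det_fromBlocks_zero₂₁]

/-- Scalar multiples of block-diagonal matrices. -/
theorem blockDiag4_smul (c : k) (A D : Matrix (Fin 2) (Fin 2) k) :
    c • blockDiag4 A D = blockDiag4 (c • A) (c • D) := by
  simp only [blockDiag4, ← map_smul, Matrix.fromBlocks_smul, smul_zero]

/-- Differences of block-diagonal matrices. -/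
theorem blockDiag4_sub (A D A' D' : Matrix (Fin 2) (Fin 2) k) :
    blockDiag4 A D - blockDiag4 A' D' = blockDiag4 (A - A') (D - D') := by
  rw [sub_eq_add_neg, sub_eq_add_neg, sub_eq_add_neg, ← blockDiag4_add]
  congr 1
  simp only [blockDiag4, ← map_neg, Matrix.fromBlocks_neg, neg_zero]

/-- The quadratic relation of `ω`: `Ω² = t Ω − n`. -/
theorem omegaMat_sq (q : QuadData k) :
    omegaMat q * omegaMat q = q.t • omegaMat q - q.n • (1 : Matrix (Fin 2) (Fin 2) k) := by
  ext i j
  fin_cases i <;> fin_cases j <;> simp [omegaMat, Matrix.mul_apply, Fin.sum_univ_two] <;> ring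

/-- The determinant of the line Gram matrix: `a² (4 n − t²)`. -/
theorem det_lineGram (q : QuadData k) (a : k) : (lineGram q a).det = a ^ 2 * (4 * q.n - q.t ^ 2) := by
  simp only [lineGram, Matrix.det_smul, Fintype.card_fin, Matrix.det_fin_two_of]
  ring

/-- The `(1, 0)` entry of a block-diagonal matrix is the `(1, 0)` entry of its first block. -/
theorem blockDiag4_apply_one_zero (A D : Matrix (Fin 2) (Fin 2) k) :
    blockDiag4 A D ((finSumFinEquiv : Fin 2 ⊕ Fin 2 ≃ Fin 4) (Sum.inl 1))
      ((finSumFinEquiv : Fin 2 ⊕ Fin 2 ≃ Fin 4) (Sum.inl 0)) = A 1 0 := by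
  simp [blockDiag4, re4, coe_reindexAlgEquiv, Matrix.reindex_apply, Matrix.submatrix_apply]

/-- **The planes built from lines are genuine** (`a, b, ε ≠ 0`, `t² ≠ 4 n`). -/
theorem ofLines_isGenuine (q : QuadData k) (a b ε : k) (ha : a ≠ 0) (hb : b ≠ 0) (hε : ε ≠ 0)
    (hq : q.t ^ 2 - 4 * q.n ≠ 0) : IsGenuinePlane q (PlaneData.ofLines q a b ε) := by
  refine ⟨?_, ?_, ?_, ?_, ?_⟩
  · intro i
    fin_cases i <;> simp [PlaneData.ofLines, trace_blockDiag4, Matrix.trace_one]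
  · intro i
    fin_cases i <;> simp [PlaneData.ofLines, trace_blockDiag4, Matrix.trace_one]
  · show blockDiag4 (omegaMat q) (omegaMat q) * blockDiag4 (omegaMat q) (omegaMat q) =
      q.t • blockDiag4 (omegaMat q) (omegaMat q) - q.n • (1 : Matrix (Fin 4) (Fin 4) k)
    rw [blockDiag4_mul, omegaMat_sq, ← blockDiag4_one, blockDiag4_smul, blockDiag4_smul, blockDiag4_sub]
  · intro c h
    have h' := congrArg (fun M : Matrix (Fin 4) (Fin 4) k =>
      M ((finSumFinEquiv : Fin 2 ⊕ Fin 2 ≃ Fin 4) (Sum.inl 1)) ((finSumFinEquiv : Fin 2 ⊕ Fin 2 ≃ Fin 4) (Sum.inl 0))) h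
    simp only [PlaneData.ofLines, blockDiag4_apply_one_zero, omegaMat] at h'
    have hne : ((finSumFinEquiv : Fin 2 ⊕ Fin 2 ≃ Fin 4) (Sum.inl (1 : Fin 2)) : Fin 4) ≠
        (finSumFinEquiv : Fin 2 ⊕ Fin 2 ≃ Fin 4) (Sum.inl (0 : Fin 2)) := by
      intro heq
      have := finSumFinEquiv.injective heq
      simp at this
    rw [Matrix.smul_apply, Matrix.one_apply_ne hne, smul_zero] at h'
    simp at h'
  · show (blockDiag4 (lineGram q a) (ε • lineGram q b)).det ≠ 0
    rw [det_blockDiag4, Matrix.det_smul, det_lineGram, det_lineGram, Fintype.card_fin]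
    have h4 : 4 * q.n - q.t ^ 2 ≠ 0 := by
      intro h0; apply hq; linear_combination -h0
    apply mul_ne_zero
    · exact mul_ne_zero (pow_ne_zero 2 ha) h4
    · exact mul_ne_zero (pow_ne_zero 2 hε) (mul_ne_zero (pow_ne_zero 2 hb) h4)

/-- The seesaw plane is genuine. -/
theorem seesaw_isGenuine (q : QuadData k) (a b : k) (ha : a ≠ 0) (hb : b ≠ 0) (hq : q.t ^ 2 - 4 * q.n ≠ 0) :
    IsGenuinePlane q (PlaneData.seesaw q a b) :=
  ofLines_isGenuine q a b 1 ha hb one_ne_zero hq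

/-- The mixed plane is genuine. -/
theorem mixed_isGenuine (q : QuadData k) (a b : k) (ha : a ≠ 0) (hb : b ≠ 0) (hq : q.t ^ 2 - 4 * q.n ≠ 0) :
    IsGenuinePlane q (PlaneData.mixed q a b) :=
  ofLines_isGenuine q a b (-1) ha hb (neg_ne_zero.mpr one_ne_zero) hq

end Genuine

/-! ## v0.2 (append): the hermitian compatibility of `B` with `Ω`

`IsGenuinePlane` says nothing about how `B` and `Ω` interact; for `B` the trace form of an `E′`-HERMITIAN form
`h` one has `B(ω x, y) = Tr(ω h(x, y)) = B(x, c(ω) y)`, i.e. `Ωᵀ B = B (t − Ω)` (`c(ω) = t − ω`).  Without it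
`unitaryGroup W = {g | g Ω = Ω g, g B gᵀ = B}` need not be the unitary group of a hermitian form (L1's `IsGenuine`
carries the clause in the form `Ωᵀ B = −B Ω` of its `ω² = −d` normalisation; the two agree for `t = 0`). -/

section Hermitian

variable {k : Type} [Field k]

/-- **A genuine HERMITIAN plane**: genuine, and `B` is compatible with `Ω` as the trace form of a hermitian form:
`Ωᵀ B = B (t • 1 − Ω)`. -/
def IsHermitianPlane (q : QuadData k) (W : PlaneData k) : Prop :=
  IsGenuinePlane q W ∧ W.Ωᵀ * W.B = W.B * (q.t • (1 : Matrix (Fin 4) (Fin 4) k) - W.Ω)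

/-- The compatibility on one line: `ωᵀ G_a = G_a (t − ω)`. -/
theorem omegaMat_transpose_mul_lineGram (q : QuadData k) (a : k) :
    (omegaMat q)ᵀ * lineGram q a = lineGram q a * (q.t • (1 : Matrix (Fin 2) (Fin 2) k) - omegaMat q) := by
  ext i j
  fin_cases i <;> fin_cases j <;> simp [omegaMat, lineGram, Matrix.mul_apply, Fin.sum_univ_two] <;> ring

/-- The planes built from lines are hermitian. -/
theorem ofLines_isHermitian (q : QuadData k) (a b ε : k) (ha : a ≠ 0) (hb : b ≠ 0) (hε : ε ≠ 0)
    (hq : q.t ^ 2 - 4 * q.n ≠ 0) : IsHermitianPlane q (PlaneData.ofLines q a b ε) := by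
  refine ⟨ofLines_isGenuine q a b ε ha hb hε hq, ?_⟩
  show (blockDiag4 (omegaMat q) (omegaMat q))ᵀ * blockDiag4 (lineGram q a) (ε • lineGram q b) =
    blockDiag4 (lineGram q a) (ε • lineGram q b) *
      (q.t • (1 : Matrix (Fin 4) (Fin 4) k) - blockDiag4 (omegaMat q) (omegaMat q))
  rw [blockDiag4_transpose, blockDiag4_mul, ← blockDiag4_one, blockDiag4_smul, blockDiag4_sub, blockDiag4_mul,
    omegaMat_transpose_mul_lineGram]
  congr 1
  rw [Matrix.smul_mul, Matrix.mul_smul, omegaMat_transpose_mul_lineGram]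

/-- The seesaw plane is hermitian. -/
theorem seesaw_isHermitian (q : QuadData k) (a b : k) (ha : a ≠ 0) (hb : b ≠ 0) (hq : q.t ^ 2 - 4 * q.n ≠ 0) :
    IsHermitianPlane q (PlaneData.seesaw q a b) :=
  ofLines_isHermitian q a b 1 ha hb one_ne_zero hq

/-- The mixed plane is hermitian. -/
theorem mixed_isHermitian (q : QuadData k) (a b : k) (ha : a ≠ 0) (hb : b ≠ 0) (hq : q.t ^ 2 - 4 * q.n ≠ 0) :
    IsHermitianPlane q (PlaneData.mixed q a b) :=
  ofLines_isHermitian q a b (-1) ha hb (neg_ne_zero.mpr one_ne_zero) hq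

end Hermitian


end Summit.Ventures.HodgeRepro.Tier4.Common

end
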